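import Literature.Computability.AlgebraicComplexity.MS08SecondFundamentalTheorem
import Literature.Computability.AlgebraicComplexity.BLMW11KroneckerApproximation
import Literature.Computability.Complexity.OccurrenceObstructionsIPStability
import Literature.Computability.Complexity.OccurrenceObstructionsIPHookPositivity
import Literature.RepresentationTheory.FiniteGroups.SymmetricGroupCharacterEvaluation
import HarnessLib

/-!
# Mulmuley–Sohoni GCT II, Prop. 12.5 (`G`-separability of `SL₂ × SL₂ ⊆ SL₄`, symmetric-group
# form) REDUCED to BLMW 2011 Prop. 8.1: `BLMW2011_prop_8_1 → MS08_prop_12_5`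

Sibling proofs file (D-0014; theorems only — no definition, no statement of the tree is changed,
no named fact is introduced) of `MS08SecondFundamentalTheorem.lean` (cell `val-lit`, DAG row
MS08-B), whose one named fact is `MS08_prop_12_5` = Mulmuley–Sohoni, SIAM J. Comput. 38 (2008),
Prop. 12.5 (arXiv cs/0612134 Prop. 13.5, `main.tex` L3409–3420) in the symmetric-group form its
printed proof establishes: for every pair `(a, b) ≠ (0, 0)` of even naturals there are an even
`m ≥ 2`, `m ≥ a, b`, and `ρ ⊢ m` with `g(λ(m), μ(m), ρ) > 0` and `g(δ, δ, ρ) = 0`, where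
`λ(m) = ((m+a)/2, (m-a)/2)`, `μ(m) = ((m+b)/2, (m-b)/2)`, `δ = (m/2, m/2)`.

**What is proved here.** `MS08_prop_12_5_of_BLMW2011_prop_8_1 : BLMW2011_prop_8_1 → MS08_prop_12_5`:
GCT II Prop. 12.5 follows from (the vanishing half of) BLMW 2011, Prop. 8.1
(`BLMW11KroneckerApproximation.lean`: "`k_{π,(δδ),(δδ)}` is non-zero iff either `π` is an even
partition of `2δ` of length at most four, or `π` is an odd partition of `2δ` of length exactly
four" — which BLMW deduce from [L. Manivel, *A note on certain Kronecker coefficients*,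
arXiv:0809.3710]: for `n = 2` the algebra of highest weight vectors is polynomial with generators of
weights `(2), (22), (222), (1111)`) together with the Kronecker semigroup property, PROVED in the tree
(`kroneckerCoeff_le_kroneckerCoeff_rowAdd`, after Christandl–Harrow–Mitchison; here `rowAdd_pos_of_pos`), the one-row
coefficients `g((n), τ, τ) = 1` (`kroneckerCoeff_indiscrete_pos`) and two kernel-certified small
coefficients of `𝔖₃`, `𝔖₄` (`kroneckerCoeff_pos_iff_kronSum_pos`, the tree's verified
Murnaghan–Nakayama evaluator). So the R1 fact `MS08_prop_12_5` (its printed proof runs through the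
Remmel–Whitehead two-row formulas, absent from the tree) is a COROLLARY of the R1 fact
`BLMW2011_prop_8_1`; it is discharged the moment the latter is.

**The witnesses** (ours; the printed proof `[L3417–3737]` takes `m ≥ 4(a+b)` and two- or
four-rowed `ρ` read off the Remmel–Whitehead formulas; we take the smallest frame and a THREE-rowed
`ρ` with last part `1`, which Prop. 8.1 kills uniformly — a partition with an odd part and fewer
than four parts is neither "even of length ≤ 4" nor "odd of length exactly 4"). By the symmetry
`g(λ, μ, ρ) = g(μ, λ, ρ)` (`kroneckerCoeff_comm₁₂_holds`) assume `a ≥ b`, so `a ≥ 2`; put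
`m = a + 2`, `s = (a+b)/2`, `t = (a-b)/2`, so `λ(m) = (a+1, 1)`, `μ(m) = (s+1, t+1)`,
`δ = (a/2+1, a/2+1)`.
* `b ≥ 2`: `ρ = (s, t+1, 1)`. Positivity: `(λ, μ, ρ) = ((2,1),(2,1),(1,1,1)) + ((a-1),(s-1,t),(s-1,t))`
  row-wise, `g((2,1),(2,1),(1,1,1)) = 1 > 0` (kernel) and `g((a-1), τ, τ) > 0`.
* `b = 0`: `μ(m) = δ`, `ρ = (a/2+1, a/2, 1)`. Positivity:
  `(λ, δ, ρ) = ((3,1),(2,2),(2,1,1)) + ((a-2),(a/2-1,a/2-1),(a/2-1,a/2-1))`,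
  `g((3,1),(2,2),(2,1,1)) = 1 > 0` (kernel).
In both cases `ρ` has three parts, one of them `1`, so `g(δ, δ, ρ) = 0` by Prop. 8.1 (with BLMW's
`δ = m/2` and `π = ρ`; the tree's `Nat.Partition.rectangle 2 (m/2)` has parts `{m/2, m/2}`).

Honest framing: bookkeeping of published statements (an implication between two named facts of the
tree, both R1 in the cell's FACT-LIST); `VP ≠ VNP` is NOT proved and nothing here is progress on
it; MS's Conjectures 12.2/12.3 (general `n`) are untouched.

## References

* [MulmuleySohoniGCT2SIAM2008] K. Mulmuley, M. Sohoni, *Geometric complexity theory II*, SIAM J.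
  Comput. 38 (2008) 1175–1206 = arXiv:cs/0612134, Prop. 12.5 (e-print Prop. 13.5, `main.tex`
  L3385–3420; printed proof L3417–3737 via [Remmel–Whitehead 1994, Thms. 3.1, 3.3]).
* [BurgisserEtAl2011] P. Bürgisser, J. M. Landsberg, L. Manivel, J. Weyman, SIAM J. Comput. 40
  (2011), §8.3 Prop. 8.1 (held text `HOME/lit/pdftxt/BLMW2011` p. 22).
* [IkenmeyerPanova2017] C. Ikenmeyer, G. Panova, Adv. Math. 319 (2017), §1.1 (semigroup property;
  the tree's `kroneckerCoeff_le_kroneckerCoeff_rowAdd`).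

## Mathlib and tree

Mathlib: `Nat.Partition.ofSums` (`ofSums_parts`), `Multiset.filter_congr`, `Multiset.filter_eq_self`,
`Nat.even_iff`, `decide`. Tree: `MS08_prop_12_5`, `BLMW2011_prop_8_1`,
`kroneckerCoeff_le_kroneckerCoeff_rowAdd`, `Nat.Partition.rowAdd`, `getD_sortedParts_rowAdd`,
`getD_sortedParts_indiscrete`, `kroneckerCoeff_indiscrete_pos`, `kroneckerCoeff_congr_parts`,
`parts_eq_of_getD_sortedParts_eq`, `kroneckerCoeff_comm₁₂_holds`, `Nat.Partition.parts_rectangle`,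
`Nat.Partition.sortedParts_rectangle`, `MNEval.kronSum`, `kroneckerCoeff_pos_iff_kronSum_pos`,
`MNEval.sort_coe_eq_of_pairwise`.
-/

open scoped BigOperators

namespace Literature.Computability.AlgebraicComplexity

open Literature.NumberTheory.DiophantineGeometry
open Literature.Computability.Complexity
open Literature.RepresentationTheory.FiniteGroups.MNEval
  (kronSum kroneckerCoeff_pos_iff_kronSum_pos sort_coe_eq_of_pairwise)

/-! ### 1. Explicit partitions from sorted lists of positive parts -/

section Lists

/-- A partition given by an explicit list of parts (via `Nat.Partition.ofSums`). [folklore] -/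
private theorem ofSums_coe_parts {n : ℕ} (l : List ℕ) (hl : (l : Multiset ℕ).sum = n)
    (hpos : ∀ x ∈ l, x ≠ 0) : (Nat.Partition.ofSums n (l : Multiset ℕ) hl).parts = (l : Multiset ℕ) := by
  rw [Nat.Partition.ofSums_parts, Multiset.filter_eq_self]
  intro x hx
  exact hpos x (Multiset.mem_coe.1 hx)

/-- Its sorted parts are the list itself when the list is weakly decreasing. [folklore] -/
private theorem sortedParts_ofSums_coe {n : ℕ} (l : List ℕ) (hl : (l : Multiset ℕ).sum = n)
    (hpos : ∀ x ∈ l, x ≠ 0) (hsort : l.Pairwise (· ≥ ·)) :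
    (Nat.Partition.ofSums n (l : Multiset ℕ) hl).sortedParts = l := by
  rw [Nat.Partition.sortedParts, ofSums_coe_parts l hl hpos]
  exact sort_coe_eq_of_pairwise hsort

/-- The entries of `[p, q]` are nonzero when `p, q` are. [folklore] -/
private theorem forall_ne_zero_two {p q : ℕ} (hp : p ≠ 0) (hq : q ≠ 0) : ∀ x ∈ [p, q], x ≠ 0 := by
  intro x hx
  simp only [List.mem_cons, List.not_mem_nil, or_false] at hx
  rcases hx with rfl | rfl <;> assumption

/-- The entries of `[p, q, r]` are nonzero when `p, q, r` are. [folklore] -/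
private theorem forall_ne_zero_three {p q r : ℕ} (hp : p ≠ 0) (hq : q ≠ 0) (hr : r ≠ 0) :
    ∀ x ∈ [p, q, r], x ≠ 0 := by
  intro x hx
  simp only [List.mem_cons, List.not_mem_nil, or_false] at hx
  rcases hx with rfl | rfl | rfl <;> assumption

/-- `[p, q]` is weakly decreasing when `q ≤ p`. [folklore] -/
private theorem pairwise_ge_two {p q : ℕ} (h : q ≤ p) : [p, q].Pairwise (· ≥ ·) := by
  simp only [List.pairwise_cons, List.mem_cons, List.not_mem_nil, or_false, forall_eq,
    List.Pairwise.nil, and_true]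
  exact ⟨h, fun _ h' => (h' : False).elim⟩

/-- `[p, q, r]` is weakly decreasing when `r ≤ q ≤ p`. [folklore] -/
private theorem pairwise_ge_three {p q r : ℕ} (h1 : q ≤ p) (h2 : r ≤ q) :
    [p, q, r].Pairwise (· ≥ ·) := by
  rw [List.pairwise_cons]
  refine ⟨fun x hx => ?_, pairwise_ge_two h2⟩
  simp only [List.mem_cons, List.not_mem_nil, or_false] at hx
  rcases hx with rfl | rfl <;> omega

/-- `↑[p, q] = {x, y}` once `x = p`, `y = q`. [folklore] -/
private theorem coe_pair_eq {p q x y : ℕ} (h1 : x = p) (h2 : y = q) :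
    ((↑[p, q] : Multiset ℕ)) = {x, y} := by
  subst h1; subst h2; rfl

/-- The rows of the two-row rectangle `(t, t)` (the tree's `Nat.Partition.rectangle 2 t`).
[folklore] -/
private theorem getD_sortedParts_rectangle_two (t r : ℕ) :
    (Nat.Partition.rectangle 2 t).sortedParts.getD r 0 = if r < 2 then t else 0 := by
  rcases Nat.eq_zero_or_pos t with rfl | ht
  · have h0 : (Nat.Partition.rectangle 2 0).parts.card = 0 := by
      rw [Nat.Partition.parts_rectangle, Multiset.card_eq_zero, Multiset.filter_eq_nil]
      intro x hx
      rw [Multiset.eq_of_mem_replicate hx]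
      exact fun h => h rfl
    rw [getD_sortedParts_eq_zero _ (by rw [h0]; exact Nat.zero_le _)]
    split_ifs <;> rfl
  · rw [Nat.Partition.sortedParts_rectangle 2 t ht.ne']
    split_ifs with hr
    · rw [List.getD_eq_getElem _ _ (by simpa using hr), List.getElem_replicate]
    · exact List.getD_eq_default _ _ (by simp only [List.length_replicate]; omega)

end Lists

/-! ### 2. The two kernel-certified atoms -/

section Atoms

/-- Rows of `(2, 1)`. [folklore] -/
private theorem sortedParts_p21 : (Nat.Partition.ofSums 3 ↑[2, 1] (by decide)).sortedParts = [2, 1] :=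
  sortedParts_ofSums_coe _ _ (by decide) (by decide)

/-- Rows of `(1, 1, 1)`. [folklore] -/
private theorem sortedParts_p111 : (Nat.Partition.ofSums 3 ↑[1, 1, 1] (by decide)).sortedParts = [1, 1, 1] :=
  sortedParts_ofSums_coe _ _ (by decide) (by decide)

/-- Rows of `(3, 1)`. [folklore] -/
private theorem sortedParts_p31 : (Nat.Partition.ofSums 4 ↑[3, 1] (by decide)).sortedParts = [3, 1] :=
  sortedParts_ofSums_coe _ _ (by decide) (by decide)

/-- Rows of `(2, 2)`. [folklore] -/
private theorem sortedParts_p22 : (Nat.Partition.ofSums 4 ↑[2, 2] (by decide)).sortedParts = [2, 2] :=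
  sortedParts_ofSums_coe _ _ (by decide) (by decide)

/-- Rows of `(2, 1, 1)`. [folklore] -/
private theorem sortedParts_p211 : (Nat.Partition.ofSums 4 ↑[2, 1, 1] (by decide)).sortedParts = [2, 1, 1] :=
  sortedParts_ofSums_coe _ _ (by decide) (by decide)

/-- `g((2,1), (2,1), (1,1,1)) > 0` (it is `1`: `[2,1] ⊗ [2,1] = [3] + [2,1] + [1,1,1]` in `𝔖₃`),
certified in the kernel by the tree's Murnaghan–Nakayama evaluator. [folklore] -/
private theorem kroneckerCoeff_p21_p21_p111_pos : 0 < kroneckerCoeff ℂ (Nat.Partition.ofSums 3 ↑[2, 1] (by decide)) (Nat.Partition.ofSums 3 ↑[2, 1] (by decide)) (Nat.Partition.ofSums 3 ↑[1, 1, 1] (by decide)) := by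
  rw [kroneckerCoeff_pos_iff_kronSum_pos, sortedParts_p21, sortedParts_p111]
  decide

/-- `g((3,1), (2,2), (2,1,1)) > 0` (it is `1`: `[3,1] ⊗ [2,2] = [3,1] + [2,1,1]` in `𝔖₄`),
certified in the kernel. [folklore] -/
private theorem kroneckerCoeff_p31_p22_p211_pos : 0 < kroneckerCoeff ℂ (Nat.Partition.ofSums 4 ↑[3, 1] (by decide)) (Nat.Partition.ofSums 4 ↑[2, 2] (by decide)) (Nat.Partition.ofSums 4 ↑[2, 1, 1] (by decide)) := by
  rw [kroneckerCoeff_pos_iff_kronSum_pos, sortedParts_p31, sortedParts_p22, sortedParts_p211]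
  decide

end Atoms

/-! ### 3. The two positive families (semigroup property) -/

section Families

/-- Rows of `(e + t, t)`: `e + t`, `t`, then zeros. [folklore] -/
private theorem getD_twoRow' (e t r : ℕ) :
    ((Nat.Partition.indiscrete e).rowAdd (Nat.Partition.rectangle 2 t)).sortedParts.getD r 0 =
      if r = 0 then e + t else if r = 1 then t else 0 := by
  rw [getD_sortedParts_rowAdd, getD_sortedParts_indiscrete, getD_sortedParts_rectangle_two]
  split_ifs <;> omega

/-- **Semigroup step**: a positive atom `(A, B, C)` plus a positive triple `(A', B', C')` gives a
positive row-wise sum (the tree's `kroneckerCoeff_le_kroneckerCoeff_rowAdd`, after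
Christandl–Harrow–Mitchison / Ikenmeyer–Panova §1.1). [cite: IkenmeyerPanova2017, §1.1 (semigroup property)] -/
private theorem rowAdd_pos_of_pos {n b : ℕ} {A B C : Nat.Partition n} (h : 0 < kroneckerCoeff ℂ A B C)
    (A' B' C' : Nat.Partition b) (h' : 0 < kroneckerCoeff ℂ A' B' C') :
    0 < kroneckerCoeff ℂ (A.rowAdd A') (B.rowAdd B') (C.rowAdd C') :=
  lt_of_lt_of_le h (kroneckerCoeff_le_kroneckerCoeff_rowAdd A B C A' B' C' h')

end Families

/-! ### 4. The vanishing half of BLMW Prop. 8.1 for three-part `ρ` with a part `1` -/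

section Vanishing

/-- From BLMW 2011 Prop. 8.1: `g(δ, δ, ρ) = 0` for `δ = (k, k)` and any `ρ ⊢ 2k` with exactly
three parts one of which is `1` (such a `ρ` is neither even of length `≤ 4` nor odd of length
exactly `4`). [cite: BurgisserEtAl2011, §8.3 Prop. 8.1] -/
theorem kroneckerCoeff_rectangle_two_eq_zero_of_BLMW2011_prop_8_1 (h81 : BLMW2011_prop_8_1)
    (k : ℕ) (ρ : Nat.Partition (2 * k)) (h1 : 1 ∈ ρ.parts) (h3 : ρ.parts.card = 3) :
    kroneckerCoeff ℂ (Nat.Partition.rectangle 2 k) (Nat.Partition.rectangle 2 k) ρ = 0 := by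
  by_contra hne
  rcases ((h81 k ρ).1).1 hne with ⟨heven, _⟩ | ⟨_, hcard⟩
  · exact Nat.not_even_one (heven 1 h1)
  · omega

end Vanishing

/-! ### 5. GCT II Prop. 12.5 from BLMW Prop. 8.1 -/

section Main

/-- `filter (· ≠ 0) = filter (0 < ·)` on multisets of naturals. [folklore] -/
private theorem filter_ne_zero_eq_filter_pos (s : Multiset ℕ) :
    s.filter (· ≠ 0) = s.filter (fun x => 0 < x) :=
  Multiset.filter_congr fun _ _ => Nat.pos_iff_ne_zero.symm

/-- The parts of `Nat.Partition.rectangle 2 k`, `k ≠ 0`, are `{(2k)/2, (2k)/2}`. [folklore] -/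
private theorem parts_rectangle_two {k : ℕ} (hk : k ≠ 0) :
    (Nat.Partition.rectangle 2 k).parts = {2 * k / 2, 2 * k / 2} := by
  rw [Nat.Partition.parts_rectangle, Multiset.filter_eq_self.2 (fun _ hx => by
    rw [Multiset.eq_of_mem_replicate hx]; exact hk)]
  have e : 2 * k / 2 = k := by omega
  rw [e]
  rfl

set_option simprocs false in
/-- The core construction for `a = 2a' ≥ b = 2b'`, `a' ≥ 1`, assuming BLMW Prop. 8.1: frame
`m = a + 2`, `λ(m) = (a+1, 1)`, `μ(m) = (a'+b'+1, a'-b'+1)`, `δ = (a'+1, a'+1)` and the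
three-rowed `ρ` of the module docstring. (`simprocs` are switched off so that `simp only`
keeps the numeral conditions of the `if`s for `split_ifs`/`omega`.) [cite: MulmuleySohoniGCT2SIAM2008, Prop. 12.5 (arXiv cs/0612134 Prop. 13.5, main.tex L3385–3420)] -/
private theorem core (h81 : BLMW2011_prop_8_1) (a' b' : ℕ) (hle : b' ≤ a') (ha : 1 ≤ a') :
    ∃ (m : ℕ) (lam mu delta rho : Nat.Partition m),
      Even m ∧ 2 ≤ m ∧ 2 * a' ≤ m ∧ 2 * b' ≤ m ∧
      lam.parts = Multiset.filter (fun x => 0 < x) {(m + 2 * a') / 2, (m - 2 * a') / 2} ∧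
      mu.parts = Multiset.filter (fun x => 0 < x) {(m + 2 * b') / 2, (m - 2 * b') / 2} ∧
      delta.parts = {m / 2, m / 2} ∧
      0 < kroneckerCoeff ℂ lam mu rho ∧ kroneckerCoeff ℂ delta delta rho = 0 := by
  -- the partitions λ(m), μ(m) of the frame `m = 2(a'+1)`
  have hlam_nz : ∀ x ∈ [2 * a' + 1, 1], x ≠ 0 := forall_ne_zero_two (by omega) (by omega)
  have hlam_st : [2 * a' + 1, 1].Pairwise (· ≥ ·) := pairwise_ge_two (by omega)
  have hmu_nz : ∀ x ∈ [a' + b' + 1, a' - b' + 1], x ≠ 0 := forall_ne_zero_two (by omega) (by omega)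
  have hmu_st : [a' + b' + 1, a' - b' + 1].Pairwise (· ≥ ·) := pairwise_ge_two (by omega)
  refine ⟨2 * (a' + 1),
    Nat.Partition.ofSums (2 * (a' + 1)) ↑[2 * a' + 1, 1]
      (by simp only [Multiset.sum_coe, List.sum_cons, List.sum_nil]; omega),
    Nat.Partition.ofSums (2 * (a' + 1)) ↑[a' + b' + 1, a' - b' + 1]
      (by simp only [Multiset.sum_coe, List.sum_cons, List.sum_nil]; omega),
    Nat.Partition.rectangle 2 (a' + 1), ?_⟩
  rcases Nat.eq_zero_or_pos b' with rfl | hb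
  · -- Case `b = 0`: `μ(m) = δ`, `ρ = (a'+1, a', 1)`
    have hrho_nz : ∀ x ∈ [a' + 1, a', 1], x ≠ 0 := forall_ne_zero_three (by omega) (by omega) (by omega)
    have hrho_st : [a' + 1, a', 1].Pairwise (· ≥ ·) := pairwise_ge_three (by omega) (by omega)
    refine ⟨Nat.Partition.ofSums (2 * (a' + 1)) ↑[a' + 1, a', 1]
        (by simp only [Multiset.sum_coe, List.sum_cons, List.sum_nil]; omega),
      even_two_mul _, by omega, by omega, by omega, ?_, ?_, parts_rectangle_two (by omega), ?_, ?_⟩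
    · rw [Nat.Partition.ofSums_parts, filter_ne_zero_eq_filter_pos]
      exact congrArg _ (coe_pair_eq (by omega) (by omega))
    · rw [Nat.Partition.ofSums_parts, filter_ne_zero_eq_filter_pos]
      exact congrArg _ (coe_pair_eq (by omega) (by omega))
    · -- positivity, transported from Family B with `u = a' - 1`
      obtain ⟨u, rfl⟩ : ∃ u, a' = u + 1 := ⟨a' - 1, by omega⟩
      have hpos := rowAdd_pos_of_pos kroneckerCoeff_p31_p22_p211_pos
        (Nat.Partition.indiscrete (2 * u)) (Nat.Partition.rectangle 2 u) (Nat.Partition.rectangle 2 u)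
        (kroneckerCoeff_indiscrete_pos ℂ _)
      refine lt_of_lt_of_eq hpos (kroneckerCoeff_congr_parts (by ring) ?_ ?_ ?_)
      · refine Literature.NumberTheory.DiophantineGeometry.parts_eq_of_getD_sortedParts_eq fun r => ?_
        rw [getD_sortedParts_rowAdd, getD_sortedParts_indiscrete, sortedParts_p31,
          sortedParts_ofSums_coe _ _ hlam_nz hlam_st]
        rcases r with _ | _ | _ | r <;>
          simp only [List.getD_cons_zero, List.getD_cons_succ, List.getD_nil] <;>
          split_ifs <;> omega
      · refine Literature.NumberTheory.DiophantineGeometry.parts_eq_of_getD_sortedParts_eq fun r => ?_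
        rw [getD_sortedParts_rowAdd, getD_sortedParts_rectangle_two, sortedParts_p22,
          sortedParts_ofSums_coe _ _ hmu_nz hmu_st]
        rcases r with _ | _ | _ | r <;>
          simp only [List.getD_cons_zero, List.getD_cons_succ, List.getD_nil] <;>
          split_ifs <;> omega
      · refine Literature.NumberTheory.DiophantineGeometry.parts_eq_of_getD_sortedParts_eq fun r => ?_
        rw [getD_sortedParts_rowAdd, getD_sortedParts_rectangle_two, sortedParts_p211,
          sortedParts_ofSums_coe _ _ hrho_nz hrho_st]
        rcases r with _ | _ | _ | r <;>
          simp only [List.getD_cons_zero, List.getD_cons_succ, List.getD_nil] <;>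
          split_ifs <;> omega
    · -- vanishing
      refine kroneckerCoeff_rectangle_two_eq_zero_of_BLMW2011_prop_8_1 h81 (a' + 1) _ ?_ ?_
      · rw [ofSums_coe_parts _ _ hrho_nz, Multiset.mem_coe]
        simp
      · rw [ofSums_coe_parts _ _ hrho_nz, Multiset.coe_card]
        rfl
  · -- Case `b ≥ 2`: `ρ = (a'+b', a'-b'+1, 1)`
    have hrho_nz : ∀ x ∈ [a' + b', a' - b' + 1, 1], x ≠ 0 :=
      forall_ne_zero_three (by omega) (by omega) (by omega)
    have hrho_st : [a' + b', a' - b' + 1, 1].Pairwise (· ≥ ·) := pairwise_ge_three (by omega) (by omega)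
    refine ⟨Nat.Partition.ofSums (2 * (a' + 1)) ↑[a' + b', a' - b' + 1, 1]
        (by simp only [Multiset.sum_coe, List.sum_cons, List.sum_nil]; omega),
      even_two_mul _, by omega, by omega, by omega, ?_, ?_, parts_rectangle_two (by omega), ?_, ?_⟩
    · rw [Nat.Partition.ofSums_parts, filter_ne_zero_eq_filter_pos]
      exact congrArg _ (coe_pair_eq (by omega) (by omega))
    · rw [Nat.Partition.ofSums_parts, filter_ne_zero_eq_filter_pos]
      exact congrArg _ (coe_pair_eq (by omega) (by omega))
    · -- positivity, transported from Family A with `e = 2b' - 1`, `t = a' - b'`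
      obtain ⟨c, rfl⟩ : ∃ c, a' = b' + c := ⟨a' - b', by omega⟩
      obtain ⟨b'', rfl⟩ : ∃ b'', b' = b'' + 1 := ⟨b' - 1, by omega⟩
      have hpos := rowAdd_pos_of_pos kroneckerCoeff_p21_p21_p111_pos
        (Nat.Partition.indiscrete ((2 * b'' + 1) + 2 * c))
        ((Nat.Partition.indiscrete (2 * b'' + 1)).rowAdd (Nat.Partition.rectangle 2 c))
        ((Nat.Partition.indiscrete (2 * b'' + 1)).rowAdd (Nat.Partition.rectangle 2 c))
        (kroneckerCoeff_indiscrete_pos ℂ _)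
      refine lt_of_lt_of_eq hpos (kroneckerCoeff_congr_parts (by ring) ?_ ?_ ?_)
      · refine Literature.NumberTheory.DiophantineGeometry.parts_eq_of_getD_sortedParts_eq fun r => ?_
        rw [getD_sortedParts_rowAdd, getD_sortedParts_indiscrete, sortedParts_p21,
          sortedParts_ofSums_coe _ _ hlam_nz hlam_st]
        rcases r with _ | _ | _ | r <;>
          simp only [List.getD_cons_zero, List.getD_cons_succ, List.getD_nil] <;>
          split_ifs <;> omega
      · refine Literature.NumberTheory.DiophantineGeometry.parts_eq_of_getD_sortedParts_eq fun r => ?_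
        rw [getD_sortedParts_rowAdd, getD_twoRow', sortedParts_p21,
          sortedParts_ofSums_coe _ _ hmu_nz hmu_st]
        rcases r with _ | _ | _ | r <;>
          simp only [List.getD_cons_zero, List.getD_cons_succ, List.getD_nil] <;>
          split_ifs <;> omega
      · refine Literature.NumberTheory.DiophantineGeometry.parts_eq_of_getD_sortedParts_eq fun r => ?_
        rw [getD_sortedParts_rowAdd, getD_twoRow', sortedParts_p111,
          sortedParts_ofSums_coe _ _ hrho_nz hrho_st]
        rcases r with _ | _ | _ | r <;>
          simp only [List.getD_cons_zero, List.getD_cons_succ, List.getD_nil] <;>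
          split_ifs <;> omega
    · -- vanishing
      refine kroneckerCoeff_rectangle_two_eq_zero_of_BLMW2011_prop_8_1 h81 (a' + 1) _ ?_ ?_
      · rw [ofSums_coe_parts _ _ hrho_nz, Multiset.mem_coe]
        simp
      · rw [ofSums_coe_parts _ _ hrho_nz, Multiset.coe_card]
        rfl

/-- **GCT II Prop. 12.5 follows from BLMW 2011 Prop. 8.1** (plus the tree's PROVED Kronecker
semigroup property and one-row / kernel-certified small coefficients): the symmetric-group form of
Mulmuley–Sohoni's `n = 2` separability statement, for every pair of even `(a, b) ≠ (0, 0)`, with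
the explicit witnesses `m = max(a,b) + 2` and a three-rowed `ρ` with last part `1` (module
docstring). [cite: MulmuleySohoniGCT2SIAM2008, Prop. 12.5 (arXiv cs/0612134 Prop. 13.5, main.tex L3385–3420)] -/
theorem MS08_prop_12_5_of_BLMW2011_prop_8_1 (h81 : BLMW2011_prop_8_1) : MS08_prop_12_5 := by
  intro a b ha hb hab
  obtain ⟨a', rfl⟩ : ∃ a', a = 2 * a' := ⟨a / 2, by obtain ⟨r, hr⟩ := ha; omega⟩
  obtain ⟨b', rfl⟩ : ∃ b', b = 2 * b' := ⟨b / 2, by obtain ⟨r, hr⟩ := hb; omega⟩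
  rcases le_total b' a' with hle | hle
  · have ha' : 1 ≤ a' := by
      by_contra h0
      exact hab ⟨by omega, by omega⟩
    obtain ⟨m, lam, mu, delta, rho, h⟩ := core h81 a' b' hle ha'
    exact ⟨m, lam, mu, delta, rho, h⟩
  · have hb' : 1 ≤ b' := by
      by_contra h0
      exact hab ⟨by omega, by omega⟩
    obtain ⟨m, lam, mu, delta, rho, hm, h2, hbm, ham, hlam, hmu, hdelta, hpos, hzero⟩ :=
      core h81 b' a' hle hb'
    refine ⟨m, mu, lam, delta, rho, hm, h2, ham, hbm, hmu, hlam, hdelta, ?_, hzero⟩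
    rwa [kroneckerCoeff_comm₁₂_holds ℂ lam mu rho] at hpos

end Main

end Literature.Computability.AlgebraicComplexity
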